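import Literature.Barriers.AtomisticToContinuum.SpectralGapClosing

/-!
# Barrier companion (AtomisticToContinuum / FouriersLaw): no `N`-uniform relaxation rate for ANY boundary-driven chain at equilibrium

Companion to `Literature/Barriers/AtomisticToContinuum/SpectralGapClosing.lean` (D-0021 catalogue;
written during the 2026-08-15 barrier audit of that entry). The catalogued entry
`BeckerMenegaki2022_gapClosing` proves that the spectral gap of the boundary-driven HARMONIC chain
closes (`λ_S(M_N) ≤ γ/N`, trace identity of the Ornstein–Uhlenbeck drift matrix); the trace identity
is special to the harmonic case, and for anharmonic chains — in particular for the conjunct's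
`pinnedChain ω₂ lam β γ` with `lam, β > 0`
(`Literature.MathematicalPhysics.KineticTheory.HeatConduction.FouriersLaw`) — the `N`-dependence of
the spectral gap is listed as open [cite: BeckerMenegaki2022, §1.3 Open questions]. This file records
the elementary, model-independent reason why `N`-UNIFORM exponential relaxation (rate AND prefactor
uniform in `N`) is nevertheless impossible for every chain with baths on the two end sites, at
equal bath temperatures `T_L = T_R = T` (the base point of the linear response `δT → 0` in
`OscillatorChain.FouriersLawFor`): the bulk energy is conserved and leaves only through the two
boundary momenta.

## The argument (transport bound; printed for boundary-dissipated quantum chains)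

Žnidarič 2015, §IV.A "Gap upper bound", for chains whose dissipation acts on a bounded number of
sites: "We will show that the gap can not be larger than `∼ 1/L`, or, in other words, relaxation
can not happen in a time that grows with `L` slower than linearly. … for unitary evolution local
conservation of energy holds and therefore, because the local energy current is a bounded
operator, it will take at least a time `∝ L` for the energy of the initial state to be
dissipated, if we choose an initial state having total energy proportional to `L`."
[cite: Znidaric2015, §IV.A]. The classical `L²` version used here: let `P` be any chain
(`OscillatorChain`: pinning `U`, coupling `V`, friction `γ > 0` on the sites `0` and `N-1`),
`N ≥ 2`, `T_L = T_R = T > 0`, and `μ = Z⁻¹ e^{-H_N/T} dq dp` the Gibbs measure (stationary: the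
Liouville part preserves `e^{-H_N/T}` and each bath term `γ(T∂²_{p_i} - p_i∂_{p_i})` is symmetric
in `L²(e^{-p_i²/2T} dp_i)`; "in which case one can check explicitly that the usual Boltzmann-Gibbs
distribution is invariant" [cite: HairerMattingly2009, §1]). Then
* `L H_N = γ(T - p_0²) + γ(T - p_{N-1}²)` — PROVED below for every chain
  (`generator_hamiltonian_two_baths`; BLR eq. (25)) — so `‖L H_N‖_{L²(μ)} = 2γT` for every `N`
  (under `μ` the momenta are i.i.d. `N(0, T)`, independent of `q`, and `E(T - p²)² = 2T²`);
* `‖H_N - μ(H_N)‖_{L²(μ)} = Var_μ(H_N)^{1/2} ≥ Var_μ(∑_i p_i²/2)^{1/2} = T √(N/2)` (kinetic and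
  potential energy are independent under `μ`; `Var(p²/2) = T²/2`);
* `P_t = e^{tL}` contracts `L²(μ)` (`μ` invariant), hence `‖P_t f - f‖ ≤ t ‖L f‖ = 2γT·t` for the
  centred energy `f = H_N - μ(H_N)`.
The normed-space lemma `rate_le_of_slowObservable` (PROVED) turns these three facts into: every
decay estimate `‖P_t f‖ ≤ C e^{-λt} ‖f‖` (`t ≥ 0`) valid for this ONE observable forces
`λ ≤ 4√2 γ ln(2C)/√N` (`equilibrium_rate_bound`, PROVED with the three facts as hypotheses). So an
`L²(μ)` spectral gap in the coercive sense (`C = 1`) is `≤ 4√2 γ ln 2/√N`, a hypocoercive pair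
with polynomial prefactor `C ≤ N^k` has `λ ≤ 4√2 γ (ln 2 + k ln N)/√N → 0`, and exponential decay
of relative entropy `H(νP_t | μ) ≤ C e^{-2λt} H(ν | μ)` for all `ν` gives (linearising at
`ν = (1 + εg)μ`, `g` bounded) the `L²` estimate with prefactor `√C`, hence the same bound.

## Contents (all PROVED; no named facts)

* `rate_le_of_slowObservable` — normed space `E`, maps `P t : E → E`, a vector `f` with
  `σ ≤ ‖f‖`, `‖P t f - f‖ ≤ v t` and `‖P t f‖ ≤ C e^{-rt} ‖f‖` for `t ≥ 0` ⟹ `r ≤ 2v ln(2C)/σ`.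
* `partialP_hamiltonian` (`∂_{p_i} H_N = p_i`), `partialP_partialP_hamiltonian` (`∂²_{p_i} H_N = 1`),
  `generator_hamiltonian_explicit`, `generator_hamiltonian_two_baths`
  (`L H_N = γ(T_L - p_0²) + γ(T_R - p_{N-1}²)`, every chain, every `N ≥ 2`).
* `equilibrium_rate_bound` — the packaged bound `r ≤ 4γ ln(2C)/√(N/2)`; carries the BARRIER block.

## Design notes

As in the parent file, the measure-theoretic dictionary (Gibbs stationarity, `H_N ∈ Dom(L)`,
contractivity of `P_t` on `L²(μ)`, the two Gaussian moments) is quoted, not formalised: the Lean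
theorems are the normed-space inequality, with the dictionary's three outputs as hypotheses, and
the generator identity on which the second one rests. No positivity of `U`, `V` is used anywhere.
-/

noncomputable section

open Finset Literature.MathematicalPhysics.KineticTheory.HeatConduction

namespace Literature.Barriers.AtomisticToContinuum

/-! ### The normed-space core: a slowly moving vector cannot decay fast -/

/-- **Slow observable ⟹ slow rate.** In a (semi)normed group `E`, let `P t : E → E` (`t ≥ 0`;
think `P_t = e^{tL}` acting on `L²(μ)`) and `f : E` with `σ ≤ ‖f‖`, `0 < σ`, whose orbit moves
slowly, `‖P t f - f‖ ≤ v·t` (`0 < v`; e.g. `v = ‖L f‖` for a contraction semigroup). If the orbit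
obeys an exponential decay estimate `‖P t f‖ ≤ C e^{-r t} ‖f‖` for all `t ≥ 0`, then
`r ≤ 2 v ln(2C)/σ`: at `t* = σ/(2v)` the orbit still has norm `≥ ‖f‖/2`, so `e^{r t*} ≤ 2C`.
(No sign or size assumption on `C`, `r` is needed; `0 < 2C` follows.) [folklore] -/
theorem rate_le_of_slowObservable {E : Type*} [SeminormedAddCommGroup E] {P : ℝ → E → E} {f : E}
    {σ v C r : ℝ} (hσ : 0 < σ) (hv : 0 < v) (hσf : σ ≤ ‖f‖)
    (hslow : ∀ t, 0 ≤ t → ‖P t f - f‖ ≤ v * t)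
    (hrate : ∀ t, 0 ≤ t → ‖P t f‖ ≤ C * Real.exp (-(r * t)) * ‖f‖) :
    r ≤ 2 * v * Real.log (2 * C) / σ := by
  set t : ℝ := σ / (2 * v) with ht
  have htpos : 0 < t := by positivity
  have hfpos : 0 < ‖f‖ := hσ.trans_le hσf
  -- at time `t` the orbit has moved by at most `σ / 2 ≤ ‖f‖ / 2`
  have h1 : ‖f‖ / 2 ≤ ‖P t f‖ := by
    have hmove : ‖P t f - f‖ ≤ σ / 2 := by
      calc ‖P t f - f‖ ≤ v * t := hslow t htpos.le
        _ = σ / 2 := by rw [ht]; field_simp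
    have htri : ‖f‖ ≤ ‖P t f‖ + ‖P t f - f‖ := by
      calc ‖f‖ = ‖P t f - (P t f - f)‖ := by rw [sub_sub_cancel]
        _ ≤ ‖P t f‖ + ‖P t f - f‖ := norm_sub_le _ _
    linarith
  -- hence `1/2 ≤ C e^{-rt}`, i.e. `e^{rt} ≤ 2C`
  have h2 : (1 : ℝ) / 2 ≤ C * Real.exp (-(r * t)) := by
    have h := h1.trans (hrate t htpos.le)
    have h' : ‖f‖ * (1 / 2) ≤ ‖f‖ * (C * Real.exp (-(r * t))) := by nlinarith [h]
    exact le_of_mul_le_mul_left h' hfpos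
  have hexp : Real.exp (r * t) ≤ 2 * C := by
    have hpos : 0 < Real.exp (r * t) := Real.exp_pos _
    have h3 : Real.exp (r * t) * (1 / 2) ≤ Real.exp (r * t) * (C * Real.exp (-(r * t))) :=
      mul_le_mul_of_nonneg_left h2 hpos.le
    rw [Real.exp_neg] at h3
    field_simp at h3
    linarith
  have hC : 0 < 2 * C := (Real.exp_pos _).trans_le hexp
  have hrt : r * t ≤ Real.log (2 * C) := (Real.le_log_iff_exp_le hC).mpr hexp
  rw [le_div_iff₀ hσ]
  have : r * σ = (r * t) * (2 * v) := by rw [ht]; field_simp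
  rw [this]
  nlinarith [hrt, hv]

/-! ### `L H_N` for every chain: the energy leaves only through the two boundary momenta -/

variable {N : ℕ}

/-- `∂_{p_i} H_N = p_i` for every chain and every `N` (the Hamiltonian is `∑_i p_i²/2` plus a
function of `q`); the computation inside `OscillatorChain.generator_hamiltonian`, exported.
[folklore] -/
theorem partialP_hamiltonian (P : OscillatorChain) (i : Fin N) (x : PhaseSpace N) :
    partialP i (P.hamiltonian N) x = x.2 i := by
  simp only [partialP, OscillatorChain.hamiltonian]
  have h : (fun t : ℝ => (∑ k : Fin N, ((Function.update x.2 i t) k ^ 2 / 2 + P.U (x.1 k))) +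
      ∑ k : Fin N, ∑ j : Fin N, (if j.val = k.val + 1 then P.V (x.1 j - x.1 k) else 0)) =
      fun t => t ^ 2 / 2 + ((∑ k ∈ Finset.univ.erase i, (x.2 k ^ 2 / 2 + P.U (x.1 k))) +
        P.U (x.1 i) +
        ∑ k : Fin N, ∑ j : Fin N, (if j.val = k.val + 1 then P.V (x.1 j - x.1 k) else 0)) := by
    funext t
    rw [← Finset.add_sum_erase _ _ (Finset.mem_univ i)]
    simp only [Function.update_self]
    have : ∑ k ∈ Finset.univ.erase i, ((Function.update x.2 i t) k ^ 2 / 2 + P.U (x.1 k)) =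
        ∑ k ∈ Finset.univ.erase i, (x.2 k ^ 2 / 2 + P.U (x.1 k)) :=
      Finset.sum_congr rfl fun k hk => by
        rw [Function.update_of_ne (Finset.ne_of_mem_erase hk)]
    rw [this]; ring
  rw [h, deriv_add_const]
  have hd : HasDerivAt (fun t : ℝ => t ^ 2 / 2) (x.2 i) (x.2 i) := by
    simpa using ((hasDerivAt_pow 2 (x.2 i)).div_const 2)
  exact hd.deriv

/-- `∂²_{p_i} H_N = 1` for every chain. [folklore] -/
theorem partialP_partialP_hamiltonian (P : OscillatorChain) (i : Fin N) (x : PhaseSpace N) :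
    partialP i (partialP i (P.hamiltonian N)) x = 1 := by
  have h : (fun t : ℝ => partialP i (P.hamiltonian N) (x.1, Function.update x.2 i t)) =
      fun t => t := by
    funext t
    rw [partialP_hamiltonian]
    simp
  show deriv (fun t : ℝ => partialP i (P.hamiltonian N) (x.1, Function.update x.2 i t)) (x.2 i) = 1
  rw [h]
  exact deriv_id _

/-- **`L H_N` for every chain** (any pinning `U`, any coupling `V`, any `N`): only the bath terms
act on the energy, `(L H_N)(q, p) = γ ∑_i ([i = 0](T_L - p_i²) + [i = N-1](T_R - p_i²))` — BLR's
eq. (25) `L H = ∑_α γ (T_α - p_α²)` for the Langevin baths of eq. (10). PROVED from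
`OscillatorChain.generator_hamiltonian`, `partialP_hamiltonian`, `partialP_partialP_hamiltonian`.
[cite: BonettoLebowitzReyBellet2000, §5.2 eq. (25)] -/
theorem generator_hamiltonian_explicit (P : OscillatorChain) (N : ℕ) (T_L T_R : ℝ)
    (x : PhaseSpace N) :
    P.generator N T_L T_R (P.hamiltonian N) x =
      P.γ * ∑ i : Fin N,
        ((if i.val = 0 then T_L - x.2 i ^ 2 else 0) +
          (if i.val = N - 1 then T_R - x.2 i ^ 2 else 0)) := by
  rw [OscillatorChain.generator_hamiltonian]
  congr 1
  refine Finset.sum_congr rfl fun i _ => ?_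
  rw [partialP_partialP_hamiltonian, partialP_hamiltonian]
  split_ifs <;> ring

/-- The two-bath form for `N ≥ 2` (the end sites `0` and `N - 1` are distinct):
`L H_N = γ (T_L - p_0²) + γ (T_R - p_{N-1}²)` — the total energy changes only through the two
boundary momenta, whatever `U`, `V`. Under the Gibbs measure at `T_L = T_R = T` this function has
`L²` norm `2γT`, independent of `N` (momenta i.i.d. `N(0,T)`, `E(T - p²)² = 2T²`).
[cite: BonettoLebowitzReyBellet2000, §5.2 eq. (25)] -/
theorem generator_hamiltonian_two_baths (P : OscillatorChain) (hN : 2 ≤ N) (T_L T_R : ℝ)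
    (x : PhaseSpace N) :
    P.generator N T_L T_R (P.hamiltonian N) x =
      P.γ * ((T_L - x.2 ⟨0, by omega⟩ ^ 2) + (T_R - x.2 ⟨N - 1, by omega⟩ ^ 2)) := by
  rw [generator_hamiltonian_explicit, Finset.sum_add_distrib]
  congr 1
  have h0 : ∑ i : Fin N, (if i.val = 0 then T_L - x.2 i ^ 2 else 0) =
      T_L - x.2 ⟨0, by omega⟩ ^ 2 := by
    rw [Finset.sum_eq_single ⟨0, by omega⟩]
    · simp
    · intro b _ hb
      rw [if_neg]
      intro hb0
      exact hb (Fin.ext hb0)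
    · intro h; exact absurd (Finset.mem_univ _) h
  have h1 : ∑ i : Fin N, (if i.val = N - 1 then T_R - x.2 i ^ 2 else 0) =
      T_R - x.2 ⟨N - 1, by omega⟩ ^ 2 := by
    rw [Finset.sum_eq_single ⟨N - 1, by omega⟩]
    · simp
    · intro b _ hb
      rw [if_neg]
      intro hb0
      exact hb (Fin.ext hb0)
    · intro h; exact absurd (Finset.mem_univ _) h
  rw [h0, h1]

/-! ### The packaged equilibrium bound -/

/-- **No `N`-uniform exponential relaxation for any boundary-driven chain at equilibrium.** The normed-space form of the transport bound, with the three outputs of the Gibbs dictionary (module docstring) as hypotheses: if the centred energy `f = H_N - μ(H_N)` of an `N`-site chain (`N ≥ 1`) with bath coupling `γ > 0` at temperature `T > 0` satisfies `T√(N/2) ≤ ‖f‖` (variance of the kinetic energy), `‖P_t f - f‖ ≤ 2γT·t` (`‖L H_N‖_{L²(μ)} = 2γT`, from `generator_hamiltonian_two_baths`, and contractivity of `P_t`), and an exponential decay estimate `‖P_t f‖ ≤ C e^{-rt} ‖f‖` (`t ≥ 0`), then `r ≤ 4γ ln(2C)/√(N/2) = 4√2 γ ln(2C)/√N`. PROVED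 (`rate_le_of_slowObservable` with `σ = T√(N/2)`, `v = 2γT`).
BARRIER (D-0021), AtomisticToContinuum/FouriersLaw (companion of `BeckerMenegaki2022_gapClosing`, same technique class, scope extended from harmonic chains to every chain at equal bath temperatures):
technique_class: n-uniform-relaxation-rate n-uniform-l2-spectral-gap hypocoercive-rate entropic-bakry-emery-type-rate n-uniform-harris-lyapunov-mixing-rate (as in the parent entry: arguments controlling `D_N → κ(T)` in `OscillatorChain.FouriersLawFor` through a rate of convergence to the steady state of the `N`-site boundary-driven chain that is UNIFORM in `N`, prefactor included)
blocks: for EVERY chain `P : OscillatorChain` with `γ > 0` — any pinning `U` and coupling `V` with `∫ e^{-H_N/T} < ∞`, in particular the conjunct's anharmonic `pinnedChain ω₂ lam β γ` (`lam, β > 0`), to which the harmonic trace bound of the parent entry does not apply — every `N ≥ 2` and EQUAL bath temperatures `T_L = T_R = T > 0` (Gibbs steady state `μ`; the base point of the linear response in `FouriersLawFor`): an `L²(μ)` decay estimate `‖P_t g‖ ≤ C e^{-λt} ‖g‖` holding for the one observable `g = H_N - μ(H_N)` forces `λ ≤ 4√2 γ ln(2C)/√N` (PROVED here modulo the quoted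 dictionary); hence no spectral gap / hypocoercive `L²(μ) → L²(μ)` estimate with rate and prefactor both uniform in `N` (coercive case `C = 1`: `λ ≤ 4√2 γ ln 2/√N`; polynomial prefactor `C ≤ N^k`: `λ ≤ 4√2 γ (ln 2 + k ln N)/√N`), and no `N`-uniform exponential decay of relative entropy `H(νP_t|μ) ≤ C e^{-2λt} H(ν|μ)` for all `ν` (linearisation `ν = (1 + εg)μ` gives the `L²` estimate with prefactor `√C`) [cite: Znidaric2015, §IV.A] [cite: BonettoLebowitzReyBellet2000, §5.2 eq. (25)]
because: the bulk energy is conserved by the Hamiltonian flow and changes only through the two boundary momenta: `L H_N = γ(T - p_0²) + γ(T - p_{N-1}²)` (PROVED for every `U, V`: `generator_hamiltonian_two_baths`) has `L²(μ)`-norm `2γT` for every `N` while `‖H_N - μ(H_N)‖_{L²(μ)} ≥ T√(N/2)` (under `μ` the momenta are i.i.d. `N(0,T)` and independent of `q`), and `P_t` contracts `L²(μ)`, so the centred energy moves by at most `2γT·t` and cannot have decayed by half before `t* = √(N/2)/(4γ)` — "because the local energy current is a bounded operator, it will take at least a time `∝ L` for the energy of the initial state to be dissipated" [cite: Znidaric2015,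 §IV.A]; the normed-space step is `rate_le_of_slowObservable` (PROVED)
evasions_known: (i) friction on every site (or on `cN` sites) makes `‖L H_N‖_{L²(μ)} = γT√(2·#baths) ∼ √N` and the bound `N`-uniform, consistent with the `N`-uniform gap of the bulk-thermostatted harmonic chain [cite: BeckerMenegaki2022, Prop. 2.2 (2)]; (ii) nothing here constrains `N`-uniform functional inequalities for `μ` itself (for `pinnedChain`, `Hess H_N ≥ min(1, ω₂)` uniformly in `N`), nor rates measured in the diffusive time scale `t ∼ N²`; (iii) for `T_L ≠ T_R` the same mechanism is expected but `Var(H_N) ≳ N` and the fourth moments of the boundary momenta under the non-equilibrium steady state are not proved for anharmonic chains — not asserted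
scope_caveats: the bound `O(γ ln C/√N)` only kills `N`-UNIFORMITY: it is far above the proved harmonic order `N^{-3}` [cite: BeckerMenegaki2022, Thm 1] and the diffusive `N^{-2}` expected for a normal conductor, and it does not exclude `N`-uniform rates bought with prefactors `C_N ≥ e^{c√N}` (e.g. Harris–Lyapunov bounds with weights `e^{θH_N}` evaluated on extensive initial data, or `L²` prefactors `‖f_0‖^N` of product data [cite: Menegaki2020, Remark 1.5]); total-variation / Wasserstein versions need further input (a Poincaré inequality for `μ`, Kuwada duality) and are not asserted; for pinning-dominated chains much more is true at FIXED `N` — with homogeneous pinning `|q|^{2k}/2k`, `k > 3/2`, and harmonic coupling the generator has essential spectrum at `0` for every chain of `≥ 5` oscillators, even at `T_L = T_R` [cite: HairerMattingly2009, Thm 3.13] — whereas for coupling growing at least as fast as the pinning (the conjunct's `β > 0`) exponential convergence holds at each fixed `N` [cite: CuneoEckmannHairerReyBellet2018, Thm 2.13]; the semigroup dictionary (Gibbs stationarity at `T_L = T_R` [cite: HairerMattingly2009, §1], `H_N ∈ Dom(L)`, contractivity, Gaussian moments) is quoted, not formalised — the Lean theorem is the normed-space inequality with those three facts as hypotheses,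 plus the generator identity
status: established (elementary transport bound; Lean core PROVED)
[cite: Znidaric2015, §IV.A] [folklore] -/
theorem equilibrium_rate_bound {E : Type*} [SeminormedAddCommGroup E] {P : ℝ → E → E} {f : E}
    {C r γ T : ℝ} {N : ℕ} (hγ : 0 < γ) (hT : 0 < T) (hN : 1 ≤ N)
    (hσf : T * Real.sqrt (N / 2) ≤ ‖f‖)
    (hslow : ∀ t, 0 ≤ t → ‖P t f - f‖ ≤ 2 * γ * T * t)
    (hrate : ∀ t, 0 ≤ t → ‖P t f‖ ≤ C * Real.exp (-(r * t)) * ‖f‖) :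
    r ≤ 4 * γ * Real.log (2 * C) / Real.sqrt (N / 2) := by
  have h := rate_le_of_slowObservable (σ := T * Real.sqrt (N / 2)) (v := 2 * γ * T)
    (by positivity) (by positivity) hσf hslow hrate
  have hTne : T ≠ 0 := hT.ne'
  have hs : Real.sqrt (N / 2) ≠ 0 := (Real.sqrt_pos.mpr (by positivity)).ne'
  calc r ≤ 2 * (2 * γ * T) * Real.log (2 * C) / (T * Real.sqrt (N / 2)) := h
    _ = 4 * γ * Real.log (2 * C) / Real.sqrt (N / 2) := by
      field_simp
      ring

/-- Multiplied-out form: `r · √(N/2) ≤ 4γ ln(2C)` — with an `N`-uniform prefactor `C` the rate is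
`O(N^{-1/2})`. [folklore] -/
theorem equilibrium_rate_bound.mul_sqrt_le {E : Type*} [SeminormedAddCommGroup E] {P : ℝ → E → E}
    {f : E} {C r γ T : ℝ} {N : ℕ} (hγ : 0 < γ) (hT : 0 < T) (hN : 1 ≤ N)
    (hσf : T * Real.sqrt (N / 2) ≤ ‖f‖)
    (hslow : ∀ t, 0 ≤ t → ‖P t f - f‖ ≤ 2 * γ * T * t)
    (hrate : ∀ t, 0 ≤ t → ‖P t f‖ ≤ C * Real.exp (-(r * t)) * ‖f‖) :
    r * Real.sqrt (N / 2) ≤ 4 * γ * Real.log (2 * C) := by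
  have hs : 0 < Real.sqrt (N / 2) := Real.sqrt_pos.mpr (by positivity)
  have := equilibrium_rate_bound hγ hT hN hσf hslow hrate
  rwa [le_div_iff₀ hs] at this

end Literature.Barriers.AtomisticToContinuum
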